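import Summits.FinalStateConjecture.FinalStateConjecture.Theorems.PhaseMixingCaptureNearExtremalKappaCaptureThermalTimeStabilityCentre
import Literature.Geometry.Lorentzian.KerrConvergence
import Mathlib.Analysis.SpecialFunctions.SmoothTransition
import HarnessLib

/-!
# Crux `PhaseMixingCapture.NearExtremalKappaCapture` (stmt-FinalStateConjecture-10606), line
# `unit-temperature-front-face`, registered sub-goal `stub_captureTransferCentreConverges` of stub S4
# `stub_captureTransfer`: every MGHD of EXACT sub-extremal Kerr data converges to `g_{M,a}`

The conclusion of the crux has, for every maximal vacuum Cauchy development `𝒟` of near-Kerr data, a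
convergence conjunct `𝒟.toSpacetime.ConvergesToKerr 𝒟oc M' a' k`. At the centre of the data ball (the data
ARE the Kerr data `Kerr.data M a M`, distance `0`) the modulus pins `(M', a') = (M, a)`, so S4 demands there:
every maximal vacuum Cauchy development of the exact sub-extremal Kerr data `Cᵏ`-converges, in the
Kerr–Schild pullback gauge of `KerrConvergence.lean`, to `g_{M,a}`. This file proves it
(`stub_captureTransferCentreConverges`), for every `k`.

The late chart. Maximality (`VacuumCauchyDevelopment.IsMaximal`, Ringström 2009, Def. 16.5) embeds the Kerr
slab development `KerrSlab.development hM ha` (part 2,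
`PhaseMixingCaptureNearExtremalKappaCaptureThermalTimeStabilityCentre.lean`; carrier the slab domain
`KerrSlab.domain a M = {t* + (r − M)/4 > 0} ⊆ Kerr.region a M`) into `𝒟` by a smooth isometric open embedding
`ψ`. A late chart must be smooth on the WHOLE Kerr exterior `Kerr.exterior M a = {r > r₊} × ℝ_{t*}`
(`Spacetime.IsLateChart.contMDiff`), which is not contained in the slab domain for very negative `t*`; so we
precompose `ψ` with the **time squash** `squashChart : Kerr.exterior M a → KerrSlab.domain a M`,
`(t*, x⃗) ↦ (ρ(t*), x⃗)` with `ρ(t) = t · smoothTransition(t/m₀ + 1)` (`Real.smoothTransition`), where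
`m₀ = (r₊ − M)/4 > 0` (`margin`): `ρ` is smooth, `ρ(t) = t` for `t ≥ 0` and `ρ > −m₀` everywhere, so
that `ρ(t*) + (r − M)/4 > −m₀ + (r₊ − M)/4 = 0` on the exterior. On the open late region `{t* > 0}` the
squash is the identity inclusion, hence there `Ψ := ψ ∘ squashChart` is an open embedding with identity
differential of the squash (`mfderiv_squashChart`), and `Ψ^* g_𝒟 = ψ^* g_𝒟 = g_{M,a}`: the metric deviation
vanishes identically, with all derivatives, on an open subset of `E4` containing every leaf `{t* = τ}`,
`τ > 0`; in particular `deviationCk → 0`. The covering clause of `IsLateEmbedding` is discharged by the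
choice `𝒟oc := Ψ '' lateRegion 0` (adapted from `AreaExcessRatchet.exists_convergesToKerr_iff_lateChart`).

No named fact is consumed (`[Kerr.Facts]`, `[Kerr.SliceFacts]` are the standing instance hypotheses of
`Kerr.data`); nothing here restates S4 off the centre.

References: H. Ringström, *The Cauchy problem in General Relativity* (2009), Def. 16.5; M. Dafermos,
G. Holzegel, I. Rodnianski, M. Taylor, arXiv:2104.08222, §1 (consequence form of convergence to Kerr);
M. Dafermos, I. Rodnianski, arXiv:0811.0354, §5.1 (ingoing Kerr–Schild coordinates).
-/

-- justification: single-conjunct summit namespace `FinalStateConjecture.FinalStateConjecture` (house pattern).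
set_option linter.dupNamespace false

noncomputable section

open Set Filter Function TopologicalSpace Topology
open scoped Manifold ContDiff Topology ENNReal
open Literature.Geometry.Lorentzian

namespace Summit.FinalStateConjecture.FinalStateConjecture.Theorems.NearExtremalKappaCapture.UnitTemperatureFrontFace

namespace KerrSlab

variable {M a : ℝ}

/-! ## The time squash -/

/-- **The time squash** `ρ_m(t) = t · smoothTransition(t/m + 1)`: smooth, `ρ_m(t) = t` for `t ≥ 0`
(`m > 0`), `ρ_m(t) = 0` for `t ≤ −m`, and `−m < ρ_m` everywhere. [folklore] -/
def squash (m t : ℝ) : ℝ :=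
  t * Real.smoothTransition (t / m + 1)

/-- `ρ_m(t) = t` for `t ≥ 0` (`m > 0`). [folklore] -/
theorem squash_of_nonneg {m t : ℝ} (hm : 0 < m) (ht : 0 ≤ t) : squash m t = t := by
  have h1 : 1 ≤ t / m + 1 := by
    have := div_nonneg ht hm.le
    linarith
  rw [squash, Real.smoothTransition.one_of_one_le h1, mul_one]

/-- `−m < ρ_m(t)` for every `t` (`m > 0`): for `t ≤ −m` the cut-off vanishes, for `−m < t < 0` one has
`ρ_m(t) ≥ t`, and for `t ≥ 0` one has `ρ_m(t) ≥ 0`. [folklore] -/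
theorem neg_lt_squash {m : ℝ} (hm : 0 < m) (t : ℝ) : -m < squash m t := by
  have h0 := Real.smoothTransition.nonneg (t / m + 1)
  have h1 := Real.smoothTransition.le_one (t / m + 1)
  rcases le_or_gt t (-m) with ht | ht
  · have hz : t / m + 1 ≤ 0 := by
      have : t / m ≤ -m / m := div_le_div_of_nonneg_right ht hm.le
      rw [neg_div, div_self hm.ne'] at this
      linarith
    rw [squash, Real.smoothTransition.zero_of_nonpos hz, mul_zero]
    linarith
  · rcases le_or_gt 0 t with ht' | ht'
    · have : 0 ≤ squash m t := mul_nonneg ht' h0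
      linarith
    · have : t ≤ squash m t := by
        rw [squash]
        nlinarith
      linarith

/-- The time squash is smooth. [folklore] -/
theorem contDiff_squash (m : ℝ) : ContDiff ℝ ∞ (squash m) :=
  contDiff_id.mul (Real.smoothTransition.contDiff.comp ((contDiff_id.div_const m).add contDiff_const))

/-- **The time squash on `E4`**: `(t*, x⃗) ↦ (ρ_m(t*), x⃗)`. [folklore] -/
def squashE (m : ℝ) (x : E4) : E4 :=
  E4.ofTimeSpace (squash m (x 0)) (E4.spatial x)

/-- The time coordinate of the squashed point is `ρ_m(t*)`. [folklore] -/
theorem squashE_apply_zero (m : ℝ) (x : E4) : squashE m x 0 = squash m (x 0) :=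
  E4.ofTimeSpace_apply_zero _ _

/-- The squash does not change the Kerr–Schild radius (it does not move the spatial part). [folklore] -/
theorem radius_squashE (m a : ℝ) (x : E4) : Kerr.radius a (squashE m x) = Kerr.radius a x := by
  rw [squashE, Kerr.radius_ofTimeSpace a _ (E4.spatial x), Kerr.radius_ofTimeSpace_spatial]

/-- The squash is the identity on `{t* ≥ 0}` (`m > 0`). [folklore] -/
theorem squashE_of_nonneg (m : ℝ) {x : E4} (hm : 0 < m) (hx : 0 ≤ x 0) : squashE m x = x := by
  rw [squashE, squash_of_nonneg hm hx]
  exact E4.ofTimeSpace_time_spatial x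

/-- The squash on `E4` is smooth. [folklore] -/
theorem contDiff_squashE (m : ℝ) : ContDiff ℝ ∞ (squashE m) := by
  have h : squashE m = fun x ↦ squash m (x 0) • E4.basisVector 0 + E4.spaceEmbed (E4.spatial x) :=
    funext fun x ↦ E4.ofTimeSpace_eq_smul_add' _ _
  rw [h]
  exact (((contDiff_squash m).comp (EuclideanSpace.proj (𝕜 := ℝ) (0 : Fin 4)).contDiff).smul
    contDiff_const).add (E4.spaceEmbed.contDiff.comp E4.spatial.contDiff)

/-- On the open half-space `{t* > 0}` the squash has identity derivative (`m > 0`). [folklore] -/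
theorem fderiv_squashE_of_pos (m : ℝ) {x : E4} (hm : 0 < m) (hx : 0 < x 0) :
    fderiv ℝ (squashE m) x = ContinuousLinearMap.id ℝ E4 := by
  have h0 : Continuous fun y : E4 ↦ y 0 := PiLp.continuous_apply 2 _ 0
  have hloc : squashE m =ᶠ[𝓝 x] id := by
    filter_upwards [(isOpen_lt continuous_const h0).mem_nhds hx] with y hy
    exact squashE_of_nonneg m hm (le_of_lt hy)
  rw [hloc.fderiv_eq, fderiv_id]

/-! ## The squash chart of the Kerr exterior into the slab domain -/

/-- The margin `m₀ = (r₊ − M)/4` of the slab domain over the exterior: on `{r > r₊}` one has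
`(r − M)/4 > m₀`. [folklore] -/
def margin (M a : ℝ) : ℝ :=
  (Kerr.rPlus M a - M) / 4

/-- `m₀ = (r₊ − M)/4 = √(M² − a²)/4 > 0` for sub-extremal parameters. [folklore] -/
theorem margin_pos (ha : |a| < M) : 0 < margin M a := by
  have hsq : 0 < √(M ^ 2 - a ^ 2) :=
    Real.sqrt_pos.2 (by nlinarith [abs_nonneg a, sq_abs a, abs_lt.1 ha])
  rw [margin, Kerr.rPlus_sub_self]
  positivity

/-- Exterior points have `r > r₊`. [folklore] -/
theorem rPlus_lt_radius (x : Kerr.exterior M a) : Kerr.rPlus M a < Kerr.radius a (x : E4) :=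
  Kerr.lt_radius_of_mem_region x.2

/-- The squashed exterior point lies in the chart `Kerr.region a M` (`r` is unchanged, `r > r₊ > M`).
[folklore] -/
theorem squashE_mem_region (hM : 0 < M) (ha : |a| < M) (x : Kerr.exterior M a) :
    squashE (margin M a) (x : E4) ∈ Kerr.region a M := by
  rw [Kerr.mem_region, radius_squashE, max_eq_left hM.le]
  have h1 := rPlus_lt_radius x
  have h2 := margin_pos ha
  rw [margin] at h2
  linarith

/-- The squashed exterior point lies in the slab domain: `ρ(t*) + (r − M)/4 > −m₀ + m₀ = 0`. [folklore] -/
theorem squashE_mem_domain (hM : 0 < M) (ha : |a| < M) (x : Kerr.exterior M a) :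
    (⟨squashE (margin M a) (x : E4), squashE_mem_region hM ha x⟩ : Kerr.region a M) ∈ domain a M := by
  rw [mem_domain]
  change 0 < squashE (margin M a) (x : E4) 0 + (Kerr.radius a (squashE (margin M a) (x : E4)) - M) / 4
  rw [squashE_apply_zero, radius_squashE]
  have h1 := rPlus_lt_radius x
  have h2 := neg_lt_squash (margin_pos ha) ((x : E4) 0)
  have h3 : margin M a = (Kerr.rPlus M a - M) / 4 := rfl
  linarith

/-- **The squash chart** `Kerr.exterior M a → KerrSlab.domain a M`, `(t*, x⃗) ↦ (ρ(t*), x⃗)`. [folklore] -/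
def squashChart (hM : 0 < M) (ha : |a| < M) (x : Kerr.exterior M a) : domain a M :=
  ⟨⟨squashE (margin M a) (x : E4), squashE_mem_region hM ha x⟩, squashE_mem_domain hM ha x⟩

/-- The squash chart read in `E4` is the squash (by `rfl`). [folklore] -/
theorem coe_coe_squashChart (hM : 0 < M) (ha : |a| < M) (x : Kerr.exterior M a) :
    ((squashChart hM ha x : Kerr.region a M) : E4) = squashE (margin M a) (x : E4) :=
  rfl

/-- On `{t* ≥ 0}` the squash chart is the inclusion. [folklore] -/
theorem coe_coe_squashChart_of_nonneg (hM : 0 < M) (ha : |a| < M) (x : Kerr.exterior M a)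
    (hx : 0 ≤ (x : E4) 0) : ((squashChart hM ha x : Kerr.region a M) : E4) = x :=
  squashE_of_nonneg _ (margin_pos ha) hx

/-- **The squash chart is smooth** (a smooth map of `E4` restricted to open submanifolds). [folklore] -/
theorem contMDiff_squashChart (hM : 0 < M) (ha : |a| < M) :
    ContMDiff 𝓘(ℝ, E4) (𝓡 4) ∞ (squashChart hM ha) := by
  have h2 : ContMDiff 𝓘(ℝ, E4) 𝓘(ℝ, E4) ∞ (fun x : Kerr.exterior M a ↦ squashE (margin M a) (x : E4)) :=
    (contDiff_squashE _).contMDiff.comp contMDiff_subtype_val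
  have h1 : ContMDiff 𝓘(ℝ, E4) (𝓡 4) ∞ (Subtype.val ∘ squashChart hM ha) :=
    (ContMDiff.subtypeVal_comp_iff (Kerr.region a M) (Subtype.val ∘ squashChart hM ha)).1 h2
  exact (ContMDiff.subtypeVal_comp_iff (domain a M) (squashChart hM ha)).1 h1

/-- **On the late region `{t* > 0}` the squash chart has identity differential**: read in `E4`
(`val ∘ val ∘ squashChart = squashE ∘ val`, `d(val) = id`) it is the squash, whose derivative there is the
identity. [folklore] -/
theorem mfderiv_squashChart (hM : 0 < M) (ha : |a| < M) (x : Kerr.exterior M a) (hx : 0 < (x : E4) 0) :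
    @Eq (E4 →L[ℝ] E4) (mfderiv 𝓘(ℝ, E4) (𝓡 4) (squashChart hM ha) x) (ContinuousLinearMap.id ℝ E4) := by
  have hθ : MDifferentiableAt 𝓘(ℝ, E4) (𝓡 4) (squashChart hM ha) x :=
    (contMDiff_squashChart hM ha x).mdifferentiableAt (by simp)
  have hvD : MDifferentiableAt (𝓡 4) (𝓡 4) (Subtype.val : domain a M → Kerr.region a M)
      (squashChart hM ha x) :=
    (contMDiff_subtype_val (n := ∞) (U := domain a M) _).mdifferentiableAt (by simp)
  have hvR : MDifferentiableAt (𝓡 4) 𝓘(ℝ, E4) (Subtype.val : Kerr.region a M → E4)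
      ((Subtype.val ∘ squashChart hM ha) x) :=
    (contMDiff_subtype_val (n := ∞) (U := Kerr.region a M) _).mdifferentiableAt (by simp)
  have hE : MDifferentiableAt 𝓘(ℝ, E4) 𝓘(ℝ, E4) (squashE (margin M a)) (x : E4) :=
    ((contDiff_squashE _).contMDiff (x : E4)).mdifferentiableAt (by simp)
  have h1 : @Eq (E4 →L[ℝ] E4)
      (mfderiv 𝓘(ℝ, E4) 𝓘(ℝ, E4) (Subtype.val ∘ Subtype.val ∘ squashChart hM ha) x)
      (mfderiv 𝓘(ℝ, E4) (𝓡 4) (squashChart hM ha) x) := by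
    rw [mfderiv_comp x hvR (hvD.comp x hθ), mfderiv_subtypeVal, mfderiv_comp x hvD hθ,
      mfderiv_subtypeVal]
    exact ContinuousLinearMap.ext fun v ↦ rfl
  have h2 : (Subtype.val ∘ Subtype.val ∘ squashChart hM ha : Kerr.exterior M a → E4) =
      squashE (margin M a) ∘ Subtype.val := rfl
  rw [← h1, h2, mfderiv_comp_subtypeVal hE, mfderiv_eq_fderiv]
  exact fderiv_squashE_of_pos _ (margin_pos ha) hx

/-- The late region `{t* > 0}` of the Kerr exterior, unfolded. [folklore] -/
theorem lateRegion_zero_eq (M a : ℝ) :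
    Kerr.lateRegion M a 0 = {x : Kerr.exterior M a | 0 < (x : E4) 0} :=
  Set.ext fun _ ↦ Kerr.mem_lateRegion

/-- The late region `{t* > 0}` of the Kerr exterior is open. [folklore] -/
theorem isOpen_lateRegion_zero (M a : ℝ) : IsOpen (Kerr.lateRegion M a 0) := by
  rw [lateRegion_zero_eq]
  exact isOpen_lt continuous_const ((PiLp.continuous_apply 2 _ 0).comp continuous_subtype_val)

/-- **On the late region the squash chart is an open embedding**: followed by the open embedding
`val ∘ val : domain → E4` it is the open embedding `val ∘ val : {t* > 0} → E4`. [folklore] -/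
theorem isOpenEmbedding_restrict_squashChart (hM : 0 < M) (ha : |a| < M) :
    IsOpenEmbedding ((Kerr.lateRegion M a 0).restrict (squashChart hM ha)) := by
  have hg : IsOpenEmbedding (Subtype.val ∘ Subtype.val : domain a M → E4) :=
    (Kerr.region a M).2.isOpenEmbedding_subtypeVal.comp (domain a M).2.isOpenEmbedding_subtypeVal
  refine IsOpenEmbedding.of_comp _ hg ?_
  have hfun : (Subtype.val ∘ Subtype.val : domain a M → E4) ∘
      (Kerr.lateRegion M a 0).restrict (squashChart hM ha) = Subtype.val ∘ Subtype.val := by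
    funext p
    exact coe_coe_squashChart_of_nonneg hM ha p.1 (le_of_lt (Kerr.mem_lateRegion.1 p.2))
  rw [hfun]
  exact (Kerr.exterior M a).2.isOpenEmbedding_subtypeVal.comp
    (isOpen_lateRegion_zero M a).isOpenEmbedding_subtypeVal

/-! ## The late chart of a maximal development of the exact Kerr data -/

section Chart

variable [Kerr.Facts] [Kerr.SliceFacts]

/-- **Maximality embeds the Kerr slab isometrically into every maximal development of the exact Kerr
data**: for a MAXIMAL `𝒟 : VacuumCauchyDevelopment (Kerr.data M a M hM.le)` there is a smooth open
embedding `ψ : KerrSlab.domain a M → 𝒟` with `ψ^* g_𝒟 = g_{M,a}` (`VacuumCauchyDevelopment.IsMaximal`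
applied to `KerrSlab.development hM ha`, whose carrier is the slab domain and whose metric is the restricted
Kerr metric, by `rfl`). [cite: Ringstrom2009, Def. 16.5] -/
theorem exists_slab_embedding (hM : 0 < M) (ha : |a| < M)
    (𝒟 : VacuumCauchyDevelopment (Kerr.data M a M hM.le)) (h𝒟 : 𝒟.IsMaximal) :
    ∃ ψ : domain a M → 𝒟.carrier, ContMDiff (𝓡 4) (𝓡 4) ∞ ψ ∧ IsOpenEmbedding ψ ∧
      ∀ p : domain a M, @Eq (E4 →L[ℝ] E4 →L[ℝ] ℝ)
        (pullbackBilin (I := 𝓡 4) (I' := 𝓡 4) ψ 𝒟.metric.val p)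
        (Kerr.bilin M a ((p : Kerr.region a M) : E4)) := by
  obtain ⟨ψ, hψs, hψo, hψi, -, -⟩ := h𝒟 (development hM ha)
  exact ⟨ψ, hψs, hψo, fun p ↦ (hψi.2 p).trans rfl⟩

/-- **Every maximal vacuum Cauchy development of the exact sub-extremal Kerr data carries an exactly
isometric late chart of the Kerr exterior.** For `0 < M`, `|a| < M`, every `k` and every MAXIMAL
`𝒟 : VacuumCauchyDevelopment (Kerr.data M a M hM.le)` there is `Ψ : Kerr.exterior M a → 𝒟`, smooth on the
whole exterior, an open embedding on the late region `{t* > 0}`, whose `Cᵏ` metric deviation from `g_{M,a}`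
(`Spacetime.deviationCk (Kerr.background M a)`) VANISHES on every leaf `{t* = τ}`, `τ > 0`. Proof:
maximality embeds `KerrSlab.development hM ha` into `𝒟` by an isometric open embedding `ψ`
(`exists_slab_embedding`); `Ψ := ψ ∘ squashChart`. [cite: Ringstrom2009, Def. 16.5] -/
theorem exterior_chart (hM : 0 < M) (ha : Kerr.IsSubextremal M a) (k : ℕ)
    (𝒟 : VacuumCauchyDevelopment (Kerr.data M a M hM.le)) (h𝒟 : 𝒟.IsMaximal) :
    ∃ Ψ : Kerr.exterior M a → 𝒟.carrier,
      ContMDiff 𝓘(ℝ, E4) (𝓡 4) ∞ Ψ ∧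
      IsOpenEmbedding ((Kerr.lateRegion M a 0).restrict Ψ) ∧
      ∀ τ : ℝ, 0 < τ → 𝒟.toSpacetime.deviationCk (Kerr.background M a) Ψ k τ = 0 := by
  have ha' : |a| < M := ha
  obtain ⟨ψ, hψs, hψo, hψi⟩ := exists_slab_embedding hM ha' 𝒟 h𝒟
  let Ψ : Kerr.exterior M a → 𝒟.carrier := ψ ∘ squashChart hM ha'
  have hΨs : ContMDiff 𝓘(ℝ, E4) (𝓡 4) ∞ Ψ := hψs.comp (contMDiff_squashChart hM ha')
  -- the pulled-back metric is the Kerr metric on the late region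
  have hpull : ∀ x : Kerr.exterior M a, 0 < (x : E4) 0 →
      @Eq (E4 →L[ℝ] E4 →L[ℝ] ℝ) (pullbackBilin (I := 𝓡 4) (I' := 𝓘(ℝ, E4)) Ψ 𝒟.metric.val x)
        (Kerr.bilin M a x) := by
    intro x hx
    have hθ : MDifferentiableAt 𝓘(ℝ, E4) (𝓡 4) (squashChart hM ha') x :=
      (contMDiff_squashChart hM ha' x).mdifferentiableAt (by simp)
    have hψ : MDifferentiableAt (𝓡 4) (𝓡 4) ψ (squashChart hM ha' x) :=
      (hψs _).mdifferentiableAt (by simp)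
    have hcomp : @Eq (E4 →L[ℝ] E4) (mfderiv 𝓘(ℝ, E4) (𝓡 4) Ψ x)
        (mfderiv (𝓡 4) (𝓡 4) ψ (squashChart hM ha' x)) := by
      change @Eq (E4 →L[ℝ] E4) (mfderiv 𝓘(ℝ, E4) (𝓡 4) (ψ ∘ squashChart hM ha') x) _
      rw [mfderiv_comp x hψ hθ, mfderiv_squashChart hM ha' x hx]
      exact ContinuousLinearMap.ext fun v ↦ rfl
    have e1 : @Eq (E4 →L[ℝ] E4 →L[ℝ] ℝ)
        (pullbackBilin (I := 𝓡 4) (I' := 𝓘(ℝ, E4)) Ψ 𝒟.metric.val x)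
        (pullbackBilin (I := 𝓡 4) (I' := 𝓡 4) ψ 𝒟.metric.val (squashChart hM ha' x)) := by
      ext v w
      change 𝒟.metric.val (Ψ x) (mfderiv 𝓘(ℝ, E4) (𝓡 4) Ψ x v) (mfderiv 𝓘(ℝ, E4) (𝓡 4) Ψ x w) =
        𝒟.metric.val (ψ (squashChart hM ha' x)) (mfderiv (𝓡 4) (𝓡 4) ψ (squashChart hM ha' x) v)
          (mfderiv (𝓡 4) (𝓡 4) ψ (squashChart hM ha' x) w)
      rw [hcomp]
      rfl
    have e2 := hψi (squashChart hM ha' x)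
    rw [coe_coe_squashChart_of_nonneg hM ha' x hx.le] at e2
    exact e1.trans e2
  have hdev : ∀ x : Kerr.exterior M a, 0 < (x : E4) 0 →
      𝒟.toSpacetime.deviation (Kerr.background M a) Ψ x = 0 := by
    intro x hx
    change (show E4 →L[ℝ] E4 →L[ℝ] ℝ from
      pullbackBilin (I := 𝓡 4) (I' := 𝓘(ℝ, E4)) Ψ 𝒟.toSpacetime.metric.val x) - Kerr.bilin M a x = 0
    rw [hpull x hx]
    exact sub_self (Kerr.bilin M a x)
  -- the late region seen in `E4` is open, and the extended deviation vanishes on it with all derivatives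
  have h0 : Continuous fun y : E4 ↦ y 0 := PiLp.continuous_apply 2 _ 0
  have hVopen : IsOpen {z : E4 | z ∈ Kerr.exterior M a ∧ 0 < z 0} :=
    (Kerr.exterior M a).2.inter (isOpen_lt continuous_const h0)
  have hext : ∀ z : E4, z ∈ Kerr.exterior M a → 0 < z 0 →
      ∀ m : ℕ, iteratedFDeriv ℝ m (𝒟.toSpacetime.deviationExtend (Kerr.background M a) Ψ) z = 0 := by
    intro z hz hz0 m
    have hloc : 𝒟.toSpacetime.deviationExtend (Kerr.background M a) Ψ =ᶠ[𝓝 z] fun _ ↦ 0 := by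
      filter_upwards [hVopen.mem_nhds ⟨hz, hz0⟩] with z' hz'
      exact (Spacetime.deviationExtend_coe 𝒟.toSpacetime (Kerr.background M a) Ψ ⟨z', hz'.1⟩).trans
        (hdev ⟨z', hz'.1⟩ hz'.2)
    rw [(Filter.EventuallyEq.iteratedFDeriv ℝ hloc m).eq_of_nhds, iteratedFDeriv_fun_zero]
    rfl
  refine ⟨Ψ, hΨs, hψo.comp (isOpenEmbedding_restrict_squashChart hM ha'), fun τ hτ ↦ ?_⟩
  -- the deviation vanishes identically near every point of the leaf `{t* = τ}`, `τ > 0`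
  refine le_antisymm ?_ zero_le
  unfold Spacetime.deviationCk supCkENorm
  refine iSup₂_le fun m _ ↦ iSup₂_le fun z hz ↦ ?_
  obtain ⟨x, hxτ, rfl⟩ := hz
  have hx0 : (x : E4) 0 = τ := hxτ
  rw [hext (x : E4) x.2 (by rw [hx0]; exact hτ) m, enorm_zero]

end Chart

end KerrSlab

universe u

/-- A late chart with deviation tending to `0` is a `ConvergesToKerr` witness for the region it covers
(`𝒟oc := Ψ '' lateRegion τ₀`; the covering clause of `IsLateEmbedding` is then vacuous). Adapted from
`AreaExcessRatchet.exists_convergesToKerr_iff_lateChart` (the `←` direction). DHRT arXiv:2104.08222, §1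
(consequence form). [cite: arXiv210408222, §1] -/
theorem convergesToKerr_image_of_lateChart (𝓢 : Spacetime.{u} 4) (M a : ℝ) (k : ℕ) (τ₀ : ℝ)
    (Ψ : Kerr.exterior M a → 𝓢.carrier) (hc : ContMDiff 𝓘(ℝ, E4) (𝓡 4) ∞ Ψ)
    (ho : IsOpenEmbedding ((Kerr.lateRegion M a τ₀).restrict Ψ))
    (ht : Tendsto (fun τ ↦ 𝓢.deviationCk (Kerr.background M a) Ψ k τ) atTop (𝓝 0)) :
    𝓢.ConvergesToKerr (Ψ '' Kerr.lateRegion M a τ₀) M a k := by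
  refine ⟨τ₀, Ψ, ⟨⟨hc, ho, subset_rfl⟩, ?_⟩, ht⟩
  exact fun x hx ↦ (hx.2 hx.1).elim

/-- **Registered sub-goal `stub_captureTransferCentreConverges` of stub S4 (`stub_captureTransfer`) — the
convergence conjunct of the crux at the centre of the data ball.** For every order `k`, every `0 < M`, every
sub-extremal `a` and every MAXIMAL vacuum Cauchy development `𝒟` of the EXACT Kerr data
`Kerr.data M a M hM.le`, some region `𝒟oc ⊆ 𝒟` converges in `Cᵏ`, in the Kerr–Schild pullback gauge, to
`g_{M,a}` (`Spacetime.ConvergesToKerr`): the late chart is the MGHD embedding of the Kerr slab development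
precomposed with the time squash of the exterior (`KerrSlab.exterior_chart`), in which the deviation is
identically `0` on every leaf `{t* = τ}`, `τ > 0`. [cite: Ringstrom2009, Def. 16.5] -/
theorem stub_captureTransferCentreConverges :
    ∀ [Kerr.Facts] [Kerr.SliceFacts] (k : ℕ) (M : ℝ) (hM : 0 < M) (a : ℝ), Kerr.IsSubextremal M a →
    ∀ 𝒟 : VacuumCauchyDevelopment (Kerr.data M a M hM.le), 𝒟.IsMaximal →
    ∃ 𝒟oc : Set 𝒟.carrier, 𝒟.toSpacetime.ConvergesToKerr 𝒟oc M a k := by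
  intro _ _ k M hM a ha 𝒟 h𝒟
  obtain ⟨Ψ, hc, ho, hdev⟩ := KerrSlab.exterior_chart hM ha k 𝒟 h𝒟
  refine ⟨Ψ '' Kerr.lateRegion M a 0, convergesToKerr_image_of_lateChart 𝒟.toSpacetime M a k 0 Ψ hc ho ?_⟩
  refine tendsto_const_nhds.congr' ?_
  filter_upwards [eventually_gt_atTop 0] with τ hτ
  exact (hdev τ hτ).symm

end Summit.FinalStateConjecture.FinalStateConjecture.Theorems.NearExtremalKappaCapture.UnitTemperatureFrontFace

end
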